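import Summits.CriticalPhenomena.Ising3D.TaylorRegionDeltaLitOdd
import Summits.CriticalPhenomena.Ising3D.TaylorRegionDeltaLitEvenP
import Mathlib.Tactic.Linarith
import Mathlib.Tactic.Positivity
import Mathlib.Tactic.Ring
import HarnessLib

/-!
# Cheap odd pieces: piece-level remainder bounds and an inner bisection (literal-table odd cone)
(cell `pub-ising3x`, seat recog-1 gen 14; gate (g1)/(g2) — companion of `TaylorRegionDeltaLitEvenP`)

HONEST FRAMING: lottery ticket; floor = tightest certified 3D Ising CFT bounds; no exact-solution
claim without a proof. Island framing: certified exclusion region at stated derivative order and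
assumptions; not a determination of the 3D Ising critical exponents beyond that.

The landed odd pieces (`OddConeRegionDataΔ.pieceRowOK`, `oddCone_of_splitΔL`) are the four AFFINE tests `M(±1)`,
`R(±1)` on a producer breakpoint interval, with the FULL `δ`-triple bounds `lowB3` / `hiB3` (three shifts per triple,
recomputed by each of the four tests ⇒ ≈ 54 shifts per piece) and NO bisection inside — so every leaf of the producer's
joint bisection is a declaration: MEASURED on the first functional whose complete region layer passes the exact twin
(M-g2, recog-1 gen 14, box of half-width `2⁻¹⁴`): 19 904 leaves at 5 % odd margins, 13 844 at 8 % — far beyond a kernel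
budget. As for the even side (`posOnDE3P`), the `δ`-orders `1, 2` only enter through `W·|r₁| + W²·|r₂|` (`W ≤ 2⁻¹³`), so
they are bounded ONCE per piece (`remB`, landed) and a leaf shifts only the five order-0 rows (`lowBP` / `hiBP`);
the four
affine tests share those five shifts (`leafOddOK`), and a bisection `posOnOddP` to depth `dPj` runs INSIDE the piece.
Soundness `posOnOddP_sound` (bisection induction carrying `piece ⊇ leaf`, leaves by the landed `affine2_pos` /
`affine4_pos`); front-ends **`OddConeRegionDataΔ.pieceRowOKP` / `pieceOKBP`**; the assembly theorem `oddCone_of_splitΔLP` (the landed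
proof of `oddCone_of_splitΔL` with the piece step swapped) is `TaylorRegionDeltaLitOddPCone`. Elementary. [folklore]
-/

namespace Summit.CriticalPhenomena.Ising3D

open Finset Set
open Literature.Analysis.ValidatedNumerics Literature.Analysis.ValidatedNumerics.PolyMP
open Literature.Analysis.ValidatedNumerics.NumericsMP (MI)
open Literature.MathematicalPhysics.QuantumFieldTheory.ConformalBootstrap3D

/-! ### Leaf bounds of a `δ`-triple from the order-0 row on the leaf and the piece remainder -/

/-- Lower bound (scaled by `S`) of a `δ`-triple on a leaf: order-0 row shifted to the leaf, minus the piece remainder.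
[folklore] -/
def lowBP (S : ℕ) (T : ITriple) (lo hi rem : ℚ) : ℚ := (lowB S T.1 lo hi : ℚ) - rem

/-- Upper bound (scaled by `S`) of a `δ`-triple on a leaf. [folklore] -/
def hiBP (S : ℕ) (T : ITriple) (lo hi rem : ℚ) : ℚ := (hiB S T.1 lo hi : ℚ) + rem

/-- [folklore] -/
theorem lowBP_le {S : ℕ} (hS : 0 < S) {T : ITriple} {a b lo hi W : ℚ} (hW : 0 ≤ W) {r : List ℝ × List ℝ × List ℝ}
    (h : PMem3 S r T) (ha : a ≤ lo) (hb : hi ≤ b) {x : ℝ} (hlo : (lo : ℝ) ≤ x) (hhi : x ≤ hi) {δ : ℝ} (hδ : |δ| ≤ W) :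
    ((lowBP S T lo hi (remB S T a b W) : ℚ) : ℝ) ≤ val3 r x δ * S := by
  have haR : ((a : ℚ) : ℝ) ≤ x := le_trans (by exact_mod_cast ha) hlo
  have hbR : x ≤ ((b : ℚ) : ℝ) := le_trans hhi (by exact_mod_cast hb)
  have hS0 : (0 : ℝ) ≤ S := by positivity
  have e0 := lowB_le hS h.fst hlo hhi
  have e1 := rem_le_remB hS hW h haR hbR hδ
  have c := mul_le_mul_of_nonneg_right (neg_abs_le (δ * evalR r.2.1 x + δ ^ 2 * evalR r.2.2 x)) hS0
  have : val3 r x δ * S = evalR r.1 x * S + (δ * evalR r.2.1 x + δ ^ 2 * evalR r.2.2 x) * S := by rw [val3]; ring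
  rw [this, lowBP]; push_cast; linarith

/-- [folklore] -/
theorem le_hiBP {S : ℕ} (hS : 0 < S) {T : ITriple} {a b lo hi W : ℚ} (hW : 0 ≤ W) {r : List ℝ × List ℝ × List ℝ}
    (h : PMem3 S r T) (ha : a ≤ lo) (hb : hi ≤ b) {x : ℝ} (hlo : (lo : ℝ) ≤ x) (hhi : x ≤ hi) {δ : ℝ} (hδ : |δ| ≤ W) :
    val3 r x δ * S ≤ ((hiBP S T lo hi (remB S T a b W) : ℚ) : ℝ) := by
  have haR : ((a : ℚ) : ℝ) ≤ x := le_trans (by exact_mod_cast ha) hlo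
  have hbR : x ≤ ((b : ℚ) : ℝ) := le_trans hhi (by exact_mod_cast hb)
  have hS0 : (0 : ℝ) ≤ S := by positivity
  have e0 := le_hiB hS h.fst hlo hhi
  have e1 := rem_le_remB hS hW h haR hbR hδ
  have c := mul_le_mul_of_nonneg_right (le_abs_self (δ * evalR r.2.1 x + δ ^ 2 * evalR r.2.2 x)) hS0
  have : val3 r x δ * S = evalR r.1 x * S + (δ * evalR r.2.1 x + δ ^ 2 * evalR r.2.2 x) * S := by rw [val3]; ring
  rw [this, hiBP]; push_cast; linarith

/-! ### The cheap leaf test (five shifts shared by the four affine tests) and the inner bisection -/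

/-- `M(ε) > 0` on a leaf from the cheap bounds. [folklore] -/
def leafM (S : ℕ) (K1 : MI) (Lj : OddLit) (ε : ℤ) (lo hi r3 r0 : ℚ) : Bool :=
  decide (0 < lowBP S Lj.2.2.2.1 lo hi r0 * (S : ℚ) +
    mulLo (MI.mulInt K1 (-ε)) (lowBP S Lj.1 lo hi r3) (hiBP S Lj.1 lo hi r3))

/-- `R(ε) > 0` on a leaf from the cheap bounds. [folklore] -/
def leafR (S : ℕ) (K2 K3 : MI) (κ : ℚ) (Lj : OddLit) (ε : ℤ) (lo hi r3 r4 r5 rt : ℚ) : Bool :=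
  decide (0 < lowBP S Lj.2.1 lo hi r4 * (S : ℚ) - hiBP S Lj.2.2.1 lo hi r5 * (S : ℚ) +
    mulLo (smulRatMI K2 (-(ε : ℚ) * (κ / 2))) (lowBP S Lj.1 lo hi r3) (hiBP S Lj.1 lo hi r3) +
    mulLo (smulRatMI K3 (-(κ⁻¹ / 2))) (lowBP S Lj.2.2.2.2 lo hi rt) (hiBP S Lj.2.2.2.2 lo hi rt))

/-- The four affine tests `M(+1)`, `M(−1)`, `R(+1)`, `R(−1)` on a LEAF `[lo, hi]` with piece remainders
`r3 r4 r5 r0 rt` of the five triples `(q̂₃, q̂₄, q̂₅, ψ̂₀, ψ̂_t)` (the five leaf shifts are shared). [folklore] -/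
def leafOddOK (S : ℕ) (K1 K2 K3 : MI) (κ : ℚ) (Lj : OddLit) (lo hi r3 r4 r5 r0 rt : ℚ) : Bool :=
  leafM S K1 Lj 1 lo hi r3 r0 && leafM S K1 Lj (-1) lo hi r3 r0 &&
    leafR S K2 K3 κ Lj 1 lo hi r3 r4 r5 rt && leafR S K2 K3 κ Lj (-1) lo hi r3 r4 r5 rt

/-- Bisection of the piece to depth `d` with the cheap leaf test. [folklore] -/
def posOnOddP (S : ℕ) (K1 K2 K3 : MI) (κ : ℚ) (Lj : OddLit) (r3 r4 r5 r0 rt : ℚ) : ℕ → ℚ → ℚ → Bool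
  | 0, u, v => leafOddOK S K1 K2 K3 κ Lj u v r3 r4 r5 r0 rt
  | d + 1, u, v =>
      leafOddOK S K1 K2 K3 κ Lj u v r3 r4 r5 r0 rt ||
        (posOnOddP S K1 K2 K3 κ Lj r3 r4 r5 r0 rt d u ((u + v) / 2) &&
          posOnOddP S K1 K2 K3 κ Lj r3 r4 r5 r0 rt d ((u + v) / 2) v)

/-- **Soundness of the cheap leaf test**: the four affine inequalities at a point of the leaf (leaf inside the piece
on which the remainders were computed). [folklore] -/
theorem leafOddOK_sound {S : ℕ} (hS : 0 < S) {K1 K2 K3 : MI} {κ : ℚ} {Lj : OddLit} {a b lo hi Wb Wσ Wt : ℚ}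
    (hWb : 0 ≤ Wb) (hWσ : 0 ≤ Wσ) (hWt : 0 ≤ Wt)
    {r3 r4 r5 r0 rt : List ℝ × List ℝ × List ℝ} (m3 : PMem3 S r3 Lj.1) (m4 : PMem3 S r4 Lj.2.1)
    (m5 : PMem3 S r5 Lj.2.2.1) (m0 : PMem3 S r0 Lj.2.2.2.1) (mt : PMem3 S rt Lj.2.2.2.2)
    {c1 c3 : ℤ → ℝ} {ct : ℝ} (hc1 : ∀ ε : ℤ, MI.mem S (c1 ε) (MI.mulInt K1 (-ε)))
    (hc3 : ∀ ε : ℤ, MI.mem S (c3 ε) (smulRatMI K2 (-(ε : ℚ) * (κ / 2))))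
    (hct : MI.mem S ct (smulRatMI K3 (-(κ⁻¹ / 2))))
    (ha : a ≤ lo) (hb : hi ≤ b)
    (h : leafOddOK S K1 K2 K3 κ Lj lo hi (remB S Lj.1 a b Wb) (remB S Lj.2.1 a b Wσ) (remB S Lj.2.2.1 a b Wσ)
      (remB S Lj.2.2.2.1 a b 0) (remB S Lj.2.2.2.2 a b Wt) = true)
    {x : ℝ} (hlo : (lo : ℝ) ≤ x) (hhi : x ≤ hi) {δb δσ δt : ℝ} (hδb : |δb| ≤ Wb) (hδσ : |δσ| ≤ Wσ)
    (hδt : |δt| ≤ Wt) :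
    0 < val3 r0 x 0 + c1 1 * val3 r3 x δb ∧ 0 < val3 r0 x 0 + c1 (-1) * val3 r3 x δb ∧
      0 < val3 r4 x δσ - val3 r5 x δσ + c3 1 * val3 r3 x δb + ct * val3 rt x δt ∧
      0 < val3 r4 x δσ - val3 r5 x δσ + c3 (-1) * val3 r3 x δb + ct * val3 rt x δt := by
  simp only [leafOddOK, leafM, leafR, Bool.and_eq_true, decide_eq_true_eq] at h
  obtain ⟨⟨⟨hM1, hM2⟩, hR1⟩, hR2⟩ := h
  have hδ0 : |(0 : ℝ)| ≤ ((0 : ℚ) : ℝ) := by simp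
  have L0 := lowBP_le hS le_rfl m0 ha hb hlo hhi hδ0
  have L3 := lowBP_le hS hWb m3 ha hb hlo hhi hδb
  have H3 := le_hiBP hS hWb m3 ha hb hlo hhi hδb
  have L4 := lowBP_le hS hWσ m4 ha hb hlo hhi hδσ
  have H5 := le_hiBP hS hWσ m5 ha hb hlo hhi hδσ
  have Lt := lowBP_le hS hWt mt ha hb hlo hhi hδt
  have Ht := le_hiBP hS hWt mt ha hb hlo hhi hδt
  exact ⟨affine2_pos hS L0 L3 H3 (hc1 1) hM1, affine2_pos hS L0 L3 H3 (hc1 (-1)) hM2,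
    affine4_pos hS L4 H5 L3 H3 Lt Ht (hc3 1) hct hR1, affine4_pos hS L4 H5 L3 H3 Lt Ht (hc3 (-1)) hct hR2⟩

/-- **Soundness of the inner bisection with piece remainders.** [folklore] -/
theorem posOnOddP_sound {S : ℕ} (hS : 0 < S) {K1 K2 K3 : MI} {κ : ℚ} {Lj : OddLit} {Wb Wσ Wt : ℚ}
    (hWb : 0 ≤ Wb) (hWσ : 0 ≤ Wσ) (hWt : 0 ≤ Wt)
    {r3 r4 r5 r0 rt : List ℝ × List ℝ × List ℝ} (m3 : PMem3 S r3 Lj.1) (m4 : PMem3 S r4 Lj.2.1)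
    (m5 : PMem3 S r5 Lj.2.2.1) (m0 : PMem3 S r0 Lj.2.2.2.1) (mt : PMem3 S rt Lj.2.2.2.2)
    {c1 c3 : ℤ → ℝ} {ct : ℝ} (hc1 : ∀ ε : ℤ, MI.mem S (c1 ε) (MI.mulInt K1 (-ε)))
    (hc3 : ∀ ε : ℤ, MI.mem S (c3 ε) (smulRatMI K2 (-(ε : ℚ) * (κ / 2))))
    (hct : MI.mem S ct (smulRatMI K3 (-(κ⁻¹ / 2))))
    {a b : ℚ} :
    ∀ {d : ℕ} {lo hi : ℚ}, a ≤ lo → hi ≤ b →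
      posOnOddP S K1 K2 K3 κ Lj (remB S Lj.1 a b Wb) (remB S Lj.2.1 a b Wσ) (remB S Lj.2.2.1 a b Wσ)
        (remB S Lj.2.2.2.1 a b 0) (remB S Lj.2.2.2.2 a b Wt) d lo hi = true →
      ∀ {x : ℝ}, (lo : ℝ) ≤ x → x ≤ hi → ∀ {δb δσ δt : ℝ}, |δb| ≤ Wb → |δσ| ≤ Wσ → |δt| ≤ Wt →
        0 < val3 r0 x 0 + c1 1 * val3 r3 x δb ∧ 0 < val3 r0 x 0 + c1 (-1) * val3 r3 x δb ∧
          0 < val3 r4 x δσ - val3 r5 x δσ + c3 1 * val3 r3 x δb + ct * val3 rt x δt ∧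
          0 < val3 r4 x δσ - val3 r5 x δσ + c3 (-1) * val3 r3 x δb + ct * val3 rt x δt
  | 0, _, _, ha, hb, h, _, hlo, hhi, _, _, _, hδb, hδσ, hδt =>
      leafOddOK_sound hS hWb hWσ hWt m3 m4 m5 m0 mt hc1 hc3 hct ha hb h hlo hhi hδb hδσ hδt
  | d + 1, u, v, ha, hb, h, x, hlo, hhi, δb, δσ, δt, hδb, hδσ, hδt => by
      simp only [posOnOddP, Bool.or_eq_true, Bool.and_eq_true] at h
      rcases h with h | ⟨h1, h2⟩
      · exact leafOddOK_sound hS hWb hWσ hWt m3 m4 m5 m0 mt hc1 hc3 hct ha hb h hlo hhi hδb hδσ hδt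
      · have hmR : (((u + v) / 2 : ℚ) : ℝ) = ((u : ℝ) + v) / 2 := by push_cast; ring
        have huv' : u ≤ v := by
          have huv : (u : ℝ) ≤ v := hlo.trans hhi
          exact_mod_cast huv
        have hm1 : a ≤ (u + v) / 2 := by linarith
        have hm2 : (u + v) / 2 ≤ b := by linarith
        rcases le_or_gt x (((u : ℝ) + v) / 2) with hx' | hx'
        · exact posOnOddP_sound hS hWb hWσ hWt m3 m4 m5 m0 mt hc1 hc3 hct ha hm2 h1 hlo (by rw [hmR]; exact hx')
            hδb hδσ hδt
        · exact posOnOddP_sound hS hWb hWσ hWt m3 m4 m5 m0 mt hc1 hc3 hct hm1 hb h2 (by rw [hmR]; exact hx'.le) hhi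
            hδb hδσ hδt

namespace OddConeRegionDataΔ

variable (d : OddConeRegionDataΔ)

/-- ONE piece of row `j` with PIECE-LEVEL remainder bounds and the inner bisection to depth `dPj` (chunk-file form).
[folklore] -/
def pieceRowOKP (Lj : OddLit) (Bj : List ℚ) (j k : ℕ) : Bool :=
  decide (d.E1 < max d.E0 (j : ℚ)) ||
    posOnOddP d.S d.K1 d.K2 d.K3 d.κ₀Q Lj (remB d.S Lj.1 (d.bpRow Bj j k) (d.bpRow Bj j (k + 1)) d.Wb)
      (remB d.S Lj.2.1 (d.bpRow Bj j k) (d.bpRow Bj j (k + 1)) d.Wσ)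
      (remB d.S Lj.2.2.1 (d.bpRow Bj j k) (d.bpRow Bj j (k + 1)) d.Wσ)
      (remB d.S Lj.2.2.2.1 (d.bpRow Bj j k) (d.bpRow Bj j (k + 1)) 0)
      (remB d.S Lj.2.2.2.2 (d.bpRow Bj j k) (d.bpRow Bj j (k + 1)) d.Wt) d.dPj (d.bpRow Bj j k) (d.bpRow Bj j (k + 1))

/-- ONE piece of row `j` with producer breakpoints `B`, cheap form. [folklore] -/
def pieceOKBP (L : List OddLit) (B : List (List ℚ)) (j k : ℕ) : Bool :=
  d.pieceRowOKP (L.getD j noLit5) (B.getD j []) j k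

end OddConeRegionDataΔ

end Summit.CriticalPhenomena.Ising3D
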